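import Literature.MathematicalPhysics.QuantumManyBody.BoseGasFreeDirichletBEC
import Literature.MathematicalPhysics.QuantumManyBody.PeriodicBoseGasFourier
import HarnessLib

/-!
# `BecUvTail` (stmt-AtomisticToContinuum-8823), line `Sketch` — registered stub `stub_occupationWindow`

Helper for the crux skeleton `Cruxes/BecUvTail/Lines/Sketch.lean` of route `BECInfraredBound`
(`AtomisticToContinuum/BoseEinsteinCondensation`): proves the registered stub `stub_occupationWindow` verbatim.
What is proved (`stub_occupationWindow`): for `N = n + 1` particles, `0 < L`, `0 < ε < 1/4`,
`ℓ = (1 − 2ε)L`, `a = (εL, εL, εL)` and `k ∈ ℤ³`, the occupation (LSSY (1.17),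
`occupation N φ Ψ = N ∫ dY |∫ conj(φ(x)) Ψ(x, Y) dx|²`) of the window plane wave
`φ'_k = ℓ^{-3/2} e^{2πi k·x/ℓ} 1_{(εL, L−εL)³}` in an arbitrary `Ψ : (ℝ³)^N → ℂ` equals
`N ∫ dY ℓ³ |ĉ_k(x ↦ Ψ(x + a, Y))|²`, where `ĉ_k` is the Fourier coefficient of the cell `[0,ℓ)³`
(`cellFourierCoeff ℓ`, normalised so that `ĉ_k(G) = ℓ⁻³ ∫_{[0,ℓ)³} conj(e_k) G`,
`cellFourierCoeff_eq_integral`). How: slice-wise (`Y` fixed) the pairing `∫ conj(φ'_k) F` is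
computed exactly — the conjugate of the indicator mode is the indicator of the conjugate mode;
the open window `(εL, L−εL)³` is a.e. the half-open translate `a + [0,ℓ)³ = cellShift ℓ a`
(they differ by coordinate faces, Lebesgue-null: `Measure.univ_pi_Ioo_ae_eq_Icc`,
`Measure.univ_pi_Ico_ae_eq_Icc` transported by `PiLp.volume_preserving_ofLp`); the translation
`x ↦ x + a` (`setIntegral_cell_comp_add`, hypothesis-free) costs the constant phase
`e^{-2πi k·a/ℓ}`; and `e^{-2πi k·x/ℓ} = conj(e_k(x))` (`cellWave_apply`). Hence
`∫ conj(φ'_k) F = ℓ^{-3/2} e^{-2πi k·a/ℓ} ℓ³ ĉ_k(F(· + a))`, whose squared modulus is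
`ℓ³ |ĉ_k(F(· + a))|²`; plugging into the definition of `occupation` gives the claim. Every step is
an identity of (Bochner/Lebesgue) integrals, so no regularity or integrability of `Ψ` is needed.
Sources: LSSY 2005, §1.2 (1.17) (the one-particle density matrix / occupations); the Fourier
bookkeeping is folklore.
-/

noncomputable section

open MeasureTheory Filter
open scoped ENNReal NNReal BigOperators

namespace Summit.AtomisticToContinuum.BoseEinsteinCondensation.Theorems.BecUvTail

open Literature.MathematicalPhysics.QuantumManyBody.BoseGas
open scoped ComplexConjugate

/-- The open coordinate windows `{y | ∀ j, y j ∈ (a,b)}` of `ℝ³` are measurable (finite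
intersection of preimages of `(a,b)` under the continuous coordinates). [folklore] -/
private theorem measurableSet_window (a b : ℝ) :
    MeasurableSet {y : Space | ∀ j, y j ∈ Set.Ioo a b} := by
  have : {y : Space | ∀ j, y j ∈ Set.Ioo a b} = ⋂ j : Fin 3, (fun y : Space => y j) ⁻¹' Set.Ioo a b := by
    ext y; simp
  rw [this]
  exact MeasurableSet.iInter fun j => measurableSet_Ioo.preimage (by fun_prop)

/-- The open window `(εL, L−εL)³` and the half-open translated cell `a + [0,ℓ)³`,
`a = (εL,εL,εL)`, `ℓ = (1−2ε)L`, agree up to a Lebesgue-null set (they differ by the faces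
`{x_j = εL}`). [folklore] -/
private theorem window_ae_eq_cellShift (L ε : ℝ) :
    ({x : Space | ∀ j, x j ∈ Set.Ioo (ε * L) (L - ε * L)} : Set Space) =ᵐ[volume]
      cellShift ((1 - 2 * ε) * L) (WithLp.toLp 2 fun _ : Fin 3 => ε * L) := by
  have h1 : {x : Space | ∀ j, x j ∈ Set.Ioo (ε * L) (L - ε * L)} =
      (@WithLp.ofLp 2 (Fin 3 → ℝ)) ⁻¹' (Set.univ.pi fun _ => Set.Ioo (ε * L) (L - ε * L)) := by
    ext x; simp
  have h2 : cellShift ((1 - 2 * ε) * L) (WithLp.toLp 2 fun _ : Fin 3 => ε * L) =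
      (@WithLp.ofLp 2 (Fin 3 → ℝ)) ⁻¹' (Set.univ.pi fun _ => Set.Ico (ε * L) (L - ε * L)) := by
    ext x
    have hℓ : ε * L + (1 - 2 * ε) * L = L - ε * L := by ring
    simp [mem_cellShift, hℓ]
  rw [h1, h2]
  refine (PiLp.volume_preserving_ofLp (Fin 3)).quasiMeasurePreserving.preimage_ae_eq ?_
  rw [volume_pi]
  exact Measure.univ_pi_Ioo_ae_eq_Icc.trans Measure.univ_pi_Ico_ae_eq_Icc.symm

/-- The phase bookkeeping of the translation `x ↦ x + a`, `a = (εL,εL,εL)`: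
`e^{-2πi k·(x+a)/ℓ} = e^{-2πi k·a/ℓ} · conj(e_k(x))` with `e_k` the plane wave `cellWave ℓ k` of
the cell of side `ℓ = (1−2ε)L`. [folklore] -/
private theorem exp_neg_translate (L ε : ℝ) (k : Fin 3 → ℤ) (x : Space) :
    Complex.exp (-(Complex.I * ↑(2 * Real.pi / ((1 - 2 * ε) * L) *
        ∑ j, (k j : ℝ) * (x + (WithLp.toLp 2 (fun _ : Fin 3 => ε * L) : Space)) j))) =
      Complex.exp (↑(-(2 * Real.pi / ((1 - 2 * ε) * L) * ∑ j, (k j : ℝ) * (ε * L))) * Complex.I) *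
        conj (cellWave ((1 - 2 * ε) * L) k x) := by
  have hsum : (∑ j, (k j : ℝ) * (x + (WithLp.toLp 2 (fun _ : Fin 3 => ε * L) : Space)) j) =
      (∑ j, (k j : ℝ) * x j) + ∑ j, (k j : ℝ) * (ε * L) := by
    simp only [PiLp.add_apply, mul_add, Finset.sum_add_distrib]
  rw [hsum, cellWave_apply, ← Complex.exp_conj, ← Complex.exp_add]
  congr 1
  simp only [map_div₀, map_mul, map_ofNat, Complex.conj_ofReal, Complex.conj_I]
  push_cast
  ring

/-- **The window pairing as a cell Fourier coefficient.** For every `F : ℝ³ → ℂ`,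
`∫ conj(φ'_k) F = ℓ^{-3/2} e^{-2πi k·a/ℓ} · ℓ³ · ĉ_k(F(· + a))`, where
`φ'_k = ℓ^{-3/2} e^{2πi k·x/ℓ} 1_{(εL,L−εL)³}`, `ℓ = (1−2ε)L`, `a = (εL,εL,εL)` and `ĉ_k` is the
Fourier coefficient of the cell `[0,ℓ)³` (`cellFourierCoeff`): the conjugate of the indicator mode
is the indicator of the conjugate, the open window is a.e. the translated half-open cell
`a + [0,ℓ)³`, the translation `x ↦ x + a` costs a constant phase, and
`ĉ_k(G) = ℓ⁻³ ∫_{[0,ℓ)³} conj(e_k) G` (`cellFourierCoeff_eq_integral`). No hypothesis on `F`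
(all steps are identities of Bochner integrals, junk value `0` on both sides if non-integrable).
[folklore] -/
private theorem integral_conj_windowWave_mul {L ε : ℝ} (hL : 0 < L) (hε : ε < 1 / 4)
    (k : Fin 3 → ℤ) (F : Space → ℂ) :
    ∫ x, conj (({x : Space | ∀ j, x j ∈ Set.Ioo (ε * L) (L - ε * L)}.indicator fun x =>
        ((Real.sqrt (((1 - 2 * ε) * L) ^ 3))⁻¹ : ℂ) *
          Complex.exp (Complex.I * ↑(2 * Real.pi / ((1 - 2 * ε) * L) * ∑ j, (k j : ℝ) * x j))) x) *
        F x =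
      ((Real.sqrt (((1 - 2 * ε) * L) ^ 3))⁻¹ : ℂ) *
        Complex.exp (↑(-(2 * Real.pi / ((1 - 2 * ε) * L) * ∑ j, (k j : ℝ) * (ε * L))) * Complex.I) *
        ((((1 - 2 * ε) * L) ^ 3 : ℝ) : ℂ) *
        cellFourierCoeff ((1 - 2 * ε) * L)
          (fun x => F (x + (WithLp.toLp 2 (fun _ : Fin 3 => ε * L) : Space))) k := by
  have hℓ : 0 < (1 - 2 * ε) * L := mul_pos (by linarith) hL
  -- the integrand is the indicator of the window applied to the conjugate mode times `F`
  have hpt : (fun x => conj (({x : Space | ∀ j, x j ∈ Set.Ioo (ε * L) (L - ε * L)}.indicator fun x =>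
        ((Real.sqrt (((1 - 2 * ε) * L) ^ 3))⁻¹ : ℂ) *
          Complex.exp (Complex.I * ↑(2 * Real.pi / ((1 - 2 * ε) * L) * ∑ j, (k j : ℝ) * x j))) x) *
        F x) =
      {x : Space | ∀ j, x j ∈ Set.Ioo (ε * L) (L - ε * L)}.indicator fun x =>
        ((Real.sqrt (((1 - 2 * ε) * L) ^ 3))⁻¹ : ℂ) *
          Complex.exp (-(Complex.I * ↑(2 * Real.pi / ((1 - 2 * ε) * L) * ∑ j, (k j : ℝ) * x j))) *
            F x := by
    funext x
    by_cases hx : x ∈ {x : Space | ∀ j, x j ∈ Set.Ioo (ε * L) (L - ε * L)}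
    · rw [Set.indicator_of_mem hx, Set.indicator_of_mem hx, map_mul, map_inv₀, Complex.conj_ofReal,
        ← Complex.exp_conj, map_mul, Complex.conj_I, Complex.conj_ofReal, neg_mul]
    · rw [Set.indicator_of_notMem hx, Set.indicator_of_notMem hx, map_zero, zero_mul]
  have hm : ((((1 - 2 * ε) * L) ^ 3 : ℝ) : ℂ) ≠ 0 := Complex.ofReal_ne_zero.mpr (pow_pos hℓ 3).ne'
  rw [hpt, integral_indicator (measurableSet_window _ _),
    setIntegral_congr_set (window_ae_eq_cellShift L ε), ← setIntegral_cell_comp_add,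
    cellFourierCoeff_eq_integral hℓ, Complex.real_smul, Complex.ofReal_inv, ← mul_assoc,
    mul_inv_cancel_right₀ hm, ← integral_const_mul]
  refine integral_congr_ae (ae_of_all _ fun x => ?_)
  dsimp only
  rw [exp_neg_translate L ε k x]
  ring

/-- **The window pairing, squared norm in `ℝ≥0∞`**: `|∫ conj(φ'_k) F|² = ℓ³ |ĉ_k(F(· + a))|²`
(from `integral_conj_windowWave_mul`: the prefactor `ℓ^{-3/2} e^{-2πi k·a/ℓ} ℓ³` has modulus
`ℓ^{3/2}`). [folklore] -/
private theorem nnnorm_sq_integral_conj_windowWave_mul {L ε : ℝ} (hL : 0 < L) (hε : ε < 1 / 4)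
    (k : Fin 3 → ℤ) (F : Space → ℂ) :
    (‖∫ x, conj (({x : Space | ∀ j, x j ∈ Set.Ioo (ε * L) (L - ε * L)}.indicator fun x =>
        ((Real.sqrt (((1 - 2 * ε) * L) ^ 3))⁻¹ : ℂ) *
          Complex.exp (Complex.I * ↑(2 * Real.pi / ((1 - 2 * ε) * L) * ∑ j, (k j : ℝ) * x j))) x) *
        F x‖₊ : ℝ≥0∞) ^ 2 =
      ENNReal.ofReal ((1 - 2 * ε) * L) ^ 3 *
        (‖cellFourierCoeff ((1 - 2 * ε) * L)
          (fun x => F (x + (WithLp.toLp 2 (fun _ : Fin 3 => ε * L) : Space))) k‖₊ : ℝ≥0∞) ^ 2 := by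
  have hℓ : 0 < (1 - 2 * ε) * L := mul_pos (by linarith) hL
  rw [integral_conj_windowWave_mul hL hε k F, coe_nnnorm_sq_eq_ofReal, coe_nnnorm_sq_eq_ofReal,
    ← ENNReal.ofReal_pow hℓ.le, ← ENNReal.ofReal_mul (pow_nonneg hℓ.le 3)]
  congr 1
  rw [norm_mul, norm_mul, norm_mul, Complex.norm_exp_ofReal_mul_I, norm_inv,
    Complex.norm_of_nonneg (Real.sqrt_nonneg _), Complex.norm_of_nonneg (pow_nonneg hℓ.le 3),
    mul_one, mul_pow, mul_pow, inv_pow, Real.sq_sqrt (pow_nonneg hℓ.le 3),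
    pow_two (((1 - 2 * ε) * L) ^ 3), ← mul_assoc _ (((1 - 2 * ε) * L) ^ 3),
    inv_mul_cancel₀ (pow_pos hℓ 3).ne', one_mul]

/-- **Window occupations are cell Fourier coefficients of the translated slices.** For
`N = n + 1`, `0 < L`, `0 < ε < 1/4`, `ℓ = (1 − 2ε)L`, `a = (εL,εL,εL)`, `k ∈ ℤ³` and any
`Ψ : (ℝ³)^N → ℂ`: `⟨φ'_k, γ_Ψ φ'_k⟩ = N ∫ dY ℓ³ |ĉ_k(x ↦ Ψ(x + a, Y))|²`, where
`φ'_k = ℓ^{-3/2} e^{2πi k·x/ℓ} 1_{(εL,L−εL)³}` is the window plane wave and `ĉ_k` the Fourier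
coefficient of the cell `[0,ℓ)³` (`cellFourierCoeff ℓ`). Proof idea: by definition
`⟨φ, γ_Ψ φ⟩ = N ∫ dY |∫ conj(φ) Ψ(·, Y)|²` (LSSY (1.17)); for each slice `F = Ψ(·, Y)`,
`∫ conj(φ'_k) F = ℓ^{-3/2} e^{-2πi k·a/ℓ} ℓ³ ĉ_k(F(· + a))` (window a.e. equal to the translated
half-open cell `a + [0,ℓ)³`, change of variables `x ↦ x + a`, `e^{-2πi k·x/ℓ} = conj e_k(x)`,
`ĉ_k = ℓ⁻³ ∫_{[0,ℓ)³} conj(e_k) ·`), and the prefactor has modulus `ℓ^{3/2}` (registered stub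
`stub_occupationWindow` of stmt-AtomisticToContinuum-8823, verbatim).
[cite: LSSY2005, §1.2 (1.17)] -/
theorem stub_occupationWindow :
    ∀ (n : ℕ) (L ε : ℝ) (k : Fin 3 → ℤ) (Ψ : (Fin (n + 1) → EuclideanSpace ℝ (Fin 3)) → ℂ), 0 < L → 0 < ε → ε < 1 / 4 → Literature.MathematicalPhysics.QuantumManyBody.BoseGas.occupation (n + 1) ({x : EuclideanSpace ℝ (Fin 3) | ∀ j, x j ∈ Set.Ioo (ε * L) (L - ε * L)}.indicator fun x => ((Real.sqrt (((1 - 2 * ε) * L) ^ 3))⁻¹ : ℂ) * Complex.exp (Complex.I * ↑(2 * Real.pi / ((1 - 2 * ε) * L) * ∑ j, (k j : ℝ) * x j))) Ψ = (n + 1 : ENNReal) * ∫⁻ Y : Fin n → EuclideanSpace ℝ (Fin 3), ENNReal.ofReal ((1 - 2 * ε) * L) ^ 3 * (‖Literature.MathematicalPhysics.QuantumManyBody.BoseGas.cellFourierCoeff ((1 - 2 * ε) * L) (fun x => Ψ (Matrix.vecCons (x + (WithLp.toLp 2 (fun _ : Fin 3 => ε * L) : EuclideanSpace ℝ (Fin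 3))) Y)) k‖₊ : ENNReal) ^ 2 := by
  intro n L ε k Ψ hL _ hε
  rw [occupation]
  congr 1
  exact lintegral_congr fun Y =>
    nnnorm_sq_integral_conj_windowWave_mul hL hε k fun x => Ψ (Matrix.vecCons x Y)

end Summit.AtomisticToContinuum.BoseEinsteinCondensation.Theorems.BecUvTail

end
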